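import Literature.NumberTheory.LFunctions.Zhang2022.DetectorShiftParseval
import Literature.NumberTheory.LFunctions.Zhang2022.DetectorEntangledCone
import Literature.NumberTheory.LFunctions.Zhang2022.DetectorAnchorKernel

/-!
# Zhang (2022), programme F-S3 (cell landau-siegel §E, E-102 head 1, LINE B′ rung R2 = «T-B′»): on the integer
# Fourier lattice of period 2 the entangled block form of formula I is a GRAM SERIES over the anchor kernel
# `Re m₀(a,·,·)` on the apex-and-mean-vanishing sub-class — hence `Re m(a;b;h) ≥ 0` there GIVEN `Re m₀(a,·,·) ⪰ 0`

Y. Zhang, *Discrete mean estimates and the Landau–Siegel zero*, arXiv:2211.02515v1 [Zhang2022LandauSiegel] —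
an unrefereed manuscript under adjudication. **WHAT THIS IS NOT: not a claim about Theorems 1–2 of
arXiv:2211.02515, about Landau–Siegel zeros, about a repaired `Margin232`, or about Parity; nothing here asserts the
row E-102 (`Det.EdetPremise`), its head 1 `Det.EdetCone`, `Det.ConePSD a b` for any `(a,b)`, or the positivity of the
anchor kernel `Re m₀(a,·,·)` (which enters as a HYPOTHESIS). The programme SEARCHES and TYPES; no claim about
Landau–Siegel zeros, Theorems 1–2 of arXiv:2211.02515 or a repaired Margin232 until a kernel theorem says so.**

CONTEXT. Head 1 of registry row E-102 is `Det.EdetCone (Ioo 0 1) (Ioo 0 5)`: for every anchor `a`, palette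
`b : Fin K → ℝ` and vector `h` of one-sided kinked profiles (`h_j(1) = 0`) the block main-term form
`m(a;b;h) = Σ_j Σ_l P^{dd}_{(a,b_j,b_l)}(h_j,h_l)` (`Det.entangledMain`, `DetectorEntangledCone` p473997) has
`Re m ≥ 0` (`Det.ConePSD a b`). The cell's LINE B′ (ls-Bdet-typer-1 g3, E102-LINEB-PARSEVAL-NOTE §2; theory referee
ls-theory g2 2026-08-27T01:28:47Z (a); REF-B1 LB1-PROOF §8) observed that on the SUB-CLASS of profiles vanishing at
BOTH ends with mean zero (`h_j(0) = h_j(1) = 0`, `∫₀¹h_j = 0`) every boundary functional of formula I drops out and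
the integer-lattice Parseval identity of period 2 (`Literature.Analysis.Fourier.HalfPeriodParseval`, p483511)
turns `m(a;b;h)` into the explicit GRAM SERIES

  `m(a;b;h) = π·Σ_{ξ∈ℤ∖0} [(ξ+a)/ξ] · Σ_{j,l} Re m₀(a,b_j,b_l)·d_j(ξ)·conj d_l(ξ)`,  `d_j(ξ) = (ξ+b_j)·ĥ_j(ξ)`,

`ĥ(ξ) = ∫₀¹ h(y)e^{−iπξy}dy` (`Det.ghat`), `m₀ = Det.ddM0` (the confluent three-node divided difference of
`t·e^{iπ(B−t)}`): the lattice weight `(ξ+a)/ξ` is `> 0` on `ℤ∖0` exactly for anchors `a ∈ [0,1]` (the cell's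
«anchor law»), so on that sub-class `Re m(a;b;h) ≥ 0` follows from the positive-semidefiniteness of the real
symmetric anchor kernel `[Re m₀(a,b_j,b_l)]_{j,l}` («L-B′1»; desk proofs REF-B1 2026-08-27T01:53Z, ls-Bdet-num-2 g4
01:55Z, ls-Bdet-typer-1 g3 note §7; kernel leaf `DetectorAnchorKernel` = ls-Bdet-num-2 g4's pen, NOT this file).
THIS FILE proves the Gram series and the conditional sign statement, theorems only:

* Part 1 — the POLAR clamped lattice series of the collapsed bulk form `Q_e(g,h)` (`Det.shiftCore`,
  `DetectorRecipeCollapse` p479377) for TWO profiles of the sub-class: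
  `HasSum (ξ ↦ (π²/2)(ξ² + e₁ξ + e₂ + e₃/ξ)·ĝ(ξ)·conj ĥ(ξ)) (Q_e(g,h))` (`hasSum_shiftCore_clamped`) — the
  two-profile twin of `Det.hasSum_re_shiftCore_self` (`DetectorShiftParseval`, ls-Bmulti-typer-2 g3), same three
  integrations by parts (`Det.ghat_deriv`, `Det.ghat_eq_prim`) and the same Parseval bridge `Det.hasSum_ghat_mul_conj`;
* Part 2 — the polar block of an ARBITRARY real triple (repeats allowed) on the sub-class:
  `P^{dd}_b(g,h) = (1/π)(m₀(b)·Q_b(g,h) + conj(m₀(b)·Q_b(h,g)))` (`formDetPolarDD_clamped`, from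
  `Det.formDetPolarDD_eq_collapse`) and `HasSum (ξ ↦ π(ξ²+e₁ξ+e₂+e₃/ξ)·Re m₀(b)·ĝ(ξ)conj ĥ(ξ)) (P^{dd}_b(g,h))`;
* Part 3 — the entangled block form: the raw series (`hasSum_entangledMain_clamped`), the GRAM SERIES displayed
  above (`hasSum_entangledMain_clamped_gram`; `(ξ²+e₁ξ+e₂+e₃/ξ) = [(ξ+a)/ξ](ξ+b_j)(ξ+b_l)` for the triple
  `(a,b_j,b_l)`, `ξ ≠ 0`; the `ξ = 0` summand vanishes because `ĥ_j(0) = ∫h_j = 0`), and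
  **`re_entangledMain_clamped_nonneg`**: for `a ∈ [0,1]`, IF `Σ_{j,l} p_j p_l Re m₀(a,b_j,b_l) ≥ 0` for all real
  `p` (the anchor-kernel hypothesis, in the shape announced for `Det.re_ddM0_sum_nonneg`, ls-Bdet-num-2 g4 2026-08-27T02:17:48Z), THEN `Re m(a;b;h) ≥ 0`
  for every profile vector of the sub-class; `…_of_anchorPSD` takes the hypothesis in its `∀ n x p` form;
* Part 4 (v2) — **`re_entangledMain_clamped_nonneg_unconditional`**: the same with the hypothesis DISCHARGED by
  `Det.re_ddM0_sum_nonneg` (`DetectorAnchorKernel`, ls-Bdet-num-2 g4): head 1 holds on the sub-class for every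
  `a ∈ (0,1]`, every palette, unconditionally (still NOT `Det.ConePSD`: the boundary coupling is open).

Elementary real analysis (FTC / integration by parts on `[0,1]`, absolutely convergent series, finite sums);
standard axioms; 0 named facts; in Parts 1–3 the anchor-kernel positivity is a binder, in Part 4 it is the tree's theorem.
Cell landau-siegel, ls-Bdet-typer-1 g3 (LINE B′ rung R2, CLAIM 2026-08-27T02:09Z).

References: Y. Zhang, arXiv:2211.02515v1 (2022), Prop. 7.1 p.44 with (7.2), (7.19)–(7.21), §8 (8.11)–(8.23)
[pp. 44–50]; Y. Katznelson, *An introduction to harmonic analysis*, 3rd ed. (2004), Ch. I §5.5 (Parseval)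
[Katznelson2004, via `HalfPeriodParseval`]; cell-internal: HOME/ls-Bdet-typer-1/E102-LINEB-PARSEVAL-NOTE.md §2, §7.
[cite: Zhang2022LandauSiegel, Prop 7.1 p.44 with (7.2), (8.11)–(8.23)]
-/

noncomputable section

open Complex Real Set intervalIntegral Filter Topology
open _root_.MeasureTheory
open scoped ComplexConjugate

namespace Literature.NumberTheory.LFunctions.Zhang2022

open Repair

namespace Det

section TwoProfiles

variable {g g' h h' : ℝ → ℂ}

/-! ### Part 1 — the polar clamped lattice series of the bulk form `Q_e(g,h)` -/

/-- The three transform-side pairings of two sub-class profiles against `P(ξ) = ĝ(ξ)·conj ĥ(ξ)`: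
`ĝ′·conj ĥ′ = π²ξ²·P`, `i·ĝ·conj ĥ′ = πξ·P`, `i·ĝ·conj Ŝ_h = −P/(πξ)` (`S_h(x) = ∫₀ˣh`; at `ξ = 0` both sides of the
last two vanish, `ĝ(0) = ∫g = 0`). [cite: Zhang2022LandauSiegel, Prop 7.1 p.44 with (7.2), (8.11)–(8.23)] -/
private theorem polar_pairing_terms (hg : KinkedProfile g g') (hh : KinkedProfile h h')
    (hg0 : g 0 = 0) (hg1 : g 1 = 0) (hgI : (∫ x in (0:ℝ)..1, g x) = 0)
    (hh0 : h 0 = 0) (hh1 : h 1 = 0) (hhI : (∫ x in (0:ℝ)..1, h x) = 0) (ξ : ℤ) :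
    ghat g' ξ * conj (ghat h' ξ) = (π : ℂ) ^ 2 * (ξ : ℂ) ^ 2 * (ghat g ξ * conj (ghat h ξ))
    ∧ I * (ghat g ξ * conj (ghat h' ξ)) = (π : ℂ) * (ξ : ℂ) * (ghat g ξ * conj (ghat h ξ))
    ∧ I * (ghat g ξ * conj (ghat (fun x => ∫ t in (0:ℝ)..x, h t) ξ))
        = -((ghat g ξ * conj (ghat h ξ)) / ((π : ℂ) * (ξ : ℂ))) := by
  have hdg : ghat g' ξ = I * π * (ξ : ℂ) * ghat g ξ := by
    have := ghat_deriv hg hg0 hg1 ξ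
    rw [Complex.ofReal_intCast] at this
    exact this
  have hdh : ghat h' ξ = I * π * (ξ : ℂ) * ghat h ξ := by
    have := ghat_deriv hh hh0 hh1 ξ
    rw [Complex.ofReal_intCast] at this
    exact this
  have hc : conj (I * π * (ξ : ℂ)) = -(I * π * (ξ : ℂ)) := by
    simp only [map_mul, Complex.conj_I, Complex.conj_ofReal, map_intCast]; ring
  refine ⟨?_, ?_, ?_⟩
  · rw [hdg, hdh, map_mul, hc]
    linear_combination (-((π : ℂ) ^ 2 * (ξ : ℂ) ^ 2 * (ghat g ξ * conj (ghat h ξ)))) * Complex.I_mul_I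
  · rw [hdh, map_mul, hc]
    linear_combination (-((π : ℂ) * (ξ : ℂ) * (ghat g ξ * conj (ghat h ξ)))) * Complex.I_mul_I
  · by_cases hξ : ξ = 0
    · subst hξ
      simp [ghat_zero_of_integral_zero hgI]
    · have hξ' : (ξ : ℂ) ≠ 0 := by exact_mod_cast hξ
      have hπ : (π : ℂ) ≠ 0 := by exact_mod_cast Real.pi_ne_zero
      have hI : (I : ℂ) ≠ 0 := Complex.I_ne_zero
      have hne : (I * π * (ξ : ℂ)) ≠ 0 := mul_ne_zero (mul_ne_zero hI hπ) hξ'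
      have hp : ghat h ξ = I * π * (ξ : ℂ) * ghat (fun x => ∫ t in (0:ℝ)..x, h t) ξ := by
        have := ghat_eq_prim hh hhI ξ
        rw [Complex.ofReal_intCast] at this
        exact this
      have hS : ghat (fun x => ∫ t in (0:ℝ)..x, h t) ξ = ghat h ξ / (I * π * (ξ : ℂ)) := by
        rw [eq_div_iff hne, mul_comm]; exact hp.symm
      rw [hS, map_div₀, hc]
      field_simp

/-- **The POLAR clamped lattice series of the bulk form.** For every real `e₁ e₂ e₃` and every two kinked profiles
`g, h` of the apex-and-mean-vanishing sub-class (`g(0) = g(1) = 0`, `∫₀¹g = 0`, same for `h`):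
`HasSum (ξ ↦ (π²/2)·(ξ² + e₁ξ + e₂ + e₃/ξ)·ĝ(ξ)·conj ĥ(ξ)) (Q_e(g,h))` (Lean's `e₃/0 = 0`; the `ξ = 0` summand is
`(π²/2)e₂·ĝ(0)conj ĥ(0) = 0`). The two-profile twin of `Det.hasSum_re_shiftCore_self`.
[cite: Zhang2022LandauSiegel, Prop 7.1 p.44 with (7.2), (8.11)–(8.23)] -/
theorem hasSum_shiftCore_clamped (e1 e2 e3 : ℝ) (hg : KinkedProfile g g') (hh : KinkedProfile h h')
    (hg1 : g 1 = 0) (hg0 : g 0 = 0) (hgI : (∫ x in (0:ℝ)..1, g x) = 0)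
    (hh1 : h 1 = 0) (hh0 : h 0 = 0) (hhI : (∫ x in (0:ℝ)..1, h x) = 0) :
    HasSum (fun ξ : ℤ => (((π ^ 2 / 2 * ((ξ : ℝ) ^ 2 + e1 * ξ + e2 + e3 / ξ) : ℝ)) : ℂ)
        * (ghat g ξ * conj (ghat h ξ)))
      (shiftCore e1 e2 e3 g g' h h') := by
  -- the four Parseval sums
  have mg : MemLp g 2 (volume.restrict (Ioc (0:ℝ) 1)) := memLp_two_of_continuousOn hg.cont
  have mg' : MemLp g' 2 (volume.restrict (Ioc (0:ℝ) 1)) := hg.memLp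
  have mh : MemLp h 2 (volume.restrict (Ioc (0:ℝ) 1)) := memLp_two_of_continuousOn hh.cont
  have mh' : MemLp h' 2 (volume.restrict (Ioc (0:ℝ) 1)) := hh.memLp
  have mS : MemLp (fun x => ∫ t in (0:ℝ)..x, h t) 2 (volume.restrict (Ioc (0:ℝ) 1)) :=
    memLp_two_of_continuousOn (kinkedProfile_prim hh).cont
  have hA := hasSum_ghat_mul_conj mg' mh'
  have hB := (hasSum_ghat_mul_conj mg mh').mul_left I
  have hC := hasSum_ghat_mul_conj mg mh
  have hD := (hasSum_ghat_mul_conj mg mS).mul_left I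
  -- rewrite the summands on the transform side
  have tA : (fun ξ : ℤ => ghat g' ξ * conj (ghat h' ξ))
      = fun ξ : ℤ => (π : ℂ) ^ 2 * (ξ : ℂ) ^ 2 * (ghat g ξ * conj (ghat h ξ)) :=
    funext fun ξ => (polar_pairing_terms hg hh hg0 hg1 hgI hh0 hh1 hhI ξ).1
  have tB : (fun ξ : ℤ => I * (ghat g ξ * conj (ghat h' ξ)))
      = fun ξ : ℤ => (π : ℂ) * (ξ : ℂ) * (ghat g ξ * conj (ghat h ξ)) :=
    funext fun ξ => (polar_pairing_terms hg hh hg0 hg1 hgI hh0 hh1 hhI ξ).2.1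
  have tD : (fun ξ : ℤ => I * (ghat g ξ * conj (ghat (fun x => ∫ t in (0:ℝ)..x, h t) ξ)))
      = fun ξ : ℤ => -((ghat g ξ * conj (ghat h ξ)) / ((π : ℂ) * (ξ : ℂ))) :=
    funext fun ξ => (polar_pairing_terms hg hh hg0 hg1 hgI hh0 hh1 hhI ξ).2.2
  rw [tA] at hA; rw [tB] at hB; rw [tD] at hD
  have goal := ((hA.mul_left (1 / 2 : ℂ)).add ((hB.mul_left (((π * e1 / 2 : ℝ)) : ℂ)).add
    ((hC.mul_left (((π ^ 2 * e2 / 2 : ℝ)) : ℂ)).add (hD.mul_left (((-(π ^ 3 * e3) / 2 : ℝ)) : ℂ)))))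
  -- pointwise: the combined summand is the displayed one
  have hfun : (fun ξ : ℤ => 1 / 2 * ((π : ℂ) ^ 2 * (ξ : ℂ) ^ 2 * (ghat g ξ * conj (ghat h ξ)))
      + ((((π * e1 / 2 : ℝ)) : ℂ) * ((π : ℂ) * (ξ : ℂ) * (ghat g ξ * conj (ghat h ξ)))
        + ((((π ^ 2 * e2 / 2 : ℝ)) : ℂ) * (ghat g ξ * conj (ghat h ξ))
          + (((-(π ^ 3 * e3) / 2 : ℝ)) : ℂ) * -((ghat g ξ * conj (ghat h ξ)) / ((π : ℂ) * (ξ : ℂ))))))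
      = fun ξ : ℤ => (((π ^ 2 / 2 * ((ξ : ℝ) ^ 2 + e1 * ξ + e2 + e3 / ξ) : ℝ)) : ℂ)
          * (ghat g ξ * conj (ghat h ξ)) := by
    funext ξ
    by_cases hξ : ξ = 0
    · subst hξ
      simp [ghat_zero_of_integral_zero hgI]
    · have hξ' : (ξ : ℂ) ≠ 0 := by exact_mod_cast hξ
      have hξr : (ξ : ℝ) ≠ 0 := by exact_mod_cast hξ
      have hπ : (π : ℂ) ≠ 0 := by exact_mod_cast Real.pi_ne_zero
      push_cast
      field_simp
      ring
  -- the value is `Q_e(g,h)` (the product `∫g·conj ∫h` vanishes on the sub-class)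
  have hval : 1 / 2 * (2 * ∫ y in (0:ℝ)..1, g' y * conj (h' y))
      + ((((π * e1 / 2 : ℝ)) : ℂ) * (I * (2 * ∫ y in (0:ℝ)..1, g y * conj (h' y)))
        + ((((π ^ 2 * e2 / 2 : ℝ)) : ℂ) * (2 * ∫ y in (0:ℝ)..1, g y * conj (h y))
          + (((-(π ^ 3 * e3) / 2 : ℝ)) : ℂ) * (I * (2 * ∫ y in (0:ℝ)..1, g y * conj (∫ t in (0:ℝ)..y, h t)))))
      = shiftCore e1 e2 e3 g g' h h' := by
    rw [shiftCore, hgI]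
    push_cast
    ring
  rw [hfun, hval] at goal
  exact goal

/-! ### Part 2 — the polar block of an arbitrary real triple on the sub-class -/

/-- **The polar block on the apex-vanishing class collapses to the bulk:** for one-sided kinked `g, h` with
`g(0) = h(0) = 0`, `P^{dd}_b(g,h) = (1/π)·m₀(b)·Q_b(g,h) + conj((1/π)·m₀(b)·Q_b(h,g))` (both apex terms of
`Det.formDetPolarDD_eq_collapse` vanish). Any real triple, repeats allowed.
[cite: Zhang2022LandauSiegel, Prop 7.1 p.44, (7.2), (8.11)–(8.12)] -/
theorem formDetPolarDD_clamped (b : Fin 3 → ℝ) (hg : KinkedProfile g g') (hh : KinkedProfile h h')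
    (hg1 : g 1 = 0) (hh1 : h 1 = 0) (hg0 : g 0 = 0) (hh0 : h 0 = 0) :
    FormDetPolarDD b g g' h h'
      = (((1 / π : ℝ)) : ℂ) * ddM0 b * shiftCore (symE1 b) (symE2 b) (symE3 b) g g' h h'
        + conj ((((1 / π : ℝ)) : ℂ) * ddM0 b * shiftCore (symE1 b) (symE2 b) (symE3 b) h h' g g') := by
  rw [formDetPolarDD_eq_collapse b hg hh hg1 hh1, hg0, hh0]
  simp only [zero_mul, mul_zero, add_zero, sub_zero, mul_assoc]

/-- **The polar block of an arbitrary real triple as a lattice series on the sub-class:**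
`HasSum (ξ ↦ π·(ξ² + e₁ξ + e₂ + e₃/ξ)·Re m₀(b)·ĝ(ξ)·conj ĥ(ξ)) (P^{dd}_b(g,h))` for `g, h` kinked with
`g(0) = g(1) = 0`, `∫₀¹g = 0` (same for `h`), `(e₁,e₂,e₃)` the elementary symmetric functions of `b`; the moment
enters only through `Re m₀(b)` because the bulk weights are real and `Q_b` is Hermitian on the sub-class.
[cite: Zhang2022LandauSiegel, Prop 7.1 p.44 with (7.2), (8.11)–(8.23)] -/
theorem hasSum_formDetPolarDD_clamped (b : Fin 3 → ℝ) (hg : KinkedProfile g g') (hh : KinkedProfile h h')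
    (hg1 : g 1 = 0) (hh1 : h 1 = 0) (hg0 : g 0 = 0) (hh0 : h 0 = 0)
    (hgI : (∫ x in (0:ℝ)..1, g x) = 0) (hhI : (∫ x in (0:ℝ)..1, h x) = 0) :
    HasSum (fun ξ : ℤ =>
        (((π * ((ξ : ℝ) ^ 2 + symE1 b * ξ + symE2 b + symE3 b / ξ) * (ddM0 b).re : ℝ)) : ℂ)
          * (ghat g ξ * conj (ghat h ξ)))
      (FormDetPolarDD b g g' h h') := by
  have S1 := hasSum_shiftCore_clamped (symE1 b) (symE2 b) (symE3 b) hg hh hg1 hg0 hgI hh1 hh0 hhI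
  have S2 := hasSum_shiftCore_clamped (symE1 b) (symE2 b) (symE3 b) hh hg hh1 hh0 hhI hg1 hg0 hgI
  have T1 := S1.mul_left ((((1 / π : ℝ)) : ℂ) * ddM0 b)
  have T2 := Complex.hasSum_conj'.mpr (S2.mul_left ((((1 / π : ℝ)) : ℂ) * ddM0 b))
  have goal := T1.add T2
  have hfun : (fun ξ : ℤ =>
      (((1 / π : ℝ)) : ℂ) * ddM0 b *
          ((((π ^ 2 / 2 * ((ξ : ℝ) ^ 2 + symE1 b * ξ + symE2 b + symE3 b / ξ) : ℝ)) : ℂ)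
            * (ghat g ξ * conj (ghat h ξ)))
        + conj ((((1 / π : ℝ)) : ℂ) * ddM0 b *
          ((((π ^ 2 / 2 * ((ξ : ℝ) ^ 2 + symE1 b * ξ + symE2 b + symE3 b / ξ) : ℝ)) : ℂ)
            * (ghat h ξ * conj (ghat g ξ)))))
      = fun ξ : ℤ =>
        (((π * ((ξ : ℝ) ^ 2 + symE1 b * ξ + symE2 b + symE3 b / ξ) * (ddM0 b).re : ℝ)) : ℂ)
          * (ghat g ξ * conj (ghat h ξ)) := by
    funext ξ
    simp only [map_mul, Complex.conj_ofReal, Complex.conj_conj]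
    set w : ℝ := (ξ : ℝ) ^ 2 + symE1 b * ξ + symE2 b + symE3 b / ξ with hw
    have e1 : (((1 / π : ℝ)) : ℂ) * ddM0 b * ((((π ^ 2 / 2 * w : ℝ)) : ℂ) * (ghat g ξ * conj (ghat h ξ)))
        + (((1 / π : ℝ)) : ℂ) * conj (ddM0 b) * ((((π ^ 2 / 2 * w : ℝ)) : ℂ) * (conj (ghat h ξ) * ghat g ξ))
        = (((1 / π : ℝ)) : ℂ) * (((π ^ 2 / 2 * w : ℝ)) : ℂ) * (ghat g ξ * conj (ghat h ξ))
            * (ddM0 b + conj (ddM0 b)) := by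
      ring
    rw [e1, Complex.add_conj]
    have hπ : (π : ℝ) ≠ 0 := Real.pi_ne_zero
    have er : (1 / π) * (π ^ 2 / 2 * w) * (2 * (ddM0 b).re) = π * w * (ddM0 b).re := by
      field_simp
    rw [show (((1 / π : ℝ)) : ℂ) * (((π ^ 2 / 2 * w : ℝ)) : ℂ) * (ghat g ξ * conj (ghat h ξ))
          * (((2 * (ddM0 b).re : ℝ)) : ℂ)
        = ((((1 / π) * (π ^ 2 / 2 * w) * (2 * (ddM0 b).re) : ℝ)) : ℂ) * (ghat g ξ * conj (ghat h ξ)) by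
      push_cast; ring, er]
  have hval : (((1 / π : ℝ)) : ℂ) * ddM0 b * shiftCore (symE1 b) (symE2 b) (symE3 b) g g' h h'
      + conj ((((1 / π : ℝ)) : ℂ) * ddM0 b * shiftCore (symE1 b) (symE2 b) (symE3 b) h h' g g')
      = FormDetPolarDD b g g' h h' :=
    (formDetPolarDD_clamped b hg hh hg1 hh1 hg0 hh0).symm
  rw [hfun, hval] at goal
  exact goal

end TwoProfiles

/-! ### Part 3 — the entangled block form on the sub-class: the Gram series and its sign -/

section Entangled

variable {K : ℕ} {a : ℝ} {b : Fin K → ℝ} {h h' : Fin K → ℝ → ℂ}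

/-- **The entangled block form as a lattice series on the sub-class (raw weights):**
`m(a;b;h) = Σ_ξ Σ_{j,l} π·(ξ² + e₁ξ + e₂ + e₃/ξ)_{(a,b_j,b_l)}·Re m₀(a,b_j,b_l)·ĥ_j(ξ)·conj ĥ_l(ξ)` for every
profile vector with `h_j` kinked, `h_j(0) = h_j(1) = 0`, `∫₀¹h_j = 0`.
[cite: Zhang2022LandauSiegel, Prop 7.1 p.44 with (7.2), (7.19)–(7.21), (8.11)–(8.23)] -/
theorem hasSum_entangledMain_clamped (hh : ∀ j, KinkedProfile (h j) (h' j)) (h1 : ∀ j, h j 1 = 0)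
    (h0 : ∀ j, h j 0 = 0) (hI : ∀ j, (∫ x in (0:ℝ)..1, h j x) = 0) :
    HasSum (fun ξ : ℤ => ∑ j, ∑ l,
        (((π * ((ξ : ℝ) ^ 2 + symE1 ![a, b j, b l] * ξ + symE2 ![a, b j, b l] + symE3 ![a, b j, b l] / ξ)
            * (ddM0 ![a, b j, b l]).re : ℝ)) : ℂ) * (ghat (h j) ξ * conj (ghat (h l) ξ)))
      (entangledMain a b h h') := by
  unfold entangledMain
  exact hasSum_sum fun j _ => hasSum_sum fun l _ =>
    hasSum_formDetPolarDD_clamped ![a, b j, b l] (hh j) (hh l) (h1 j) (h1 l) (h0 j) (h0 l) (hI j) (hI l)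

/-- The bulk weight of the triple `(a,x,y)` at a non-zero frequency factors through the anchor:
`ξ² + e₁ξ + e₂ + e₃/ξ = [(ξ+a)/ξ]·(ξ+x)(ξ+y)`. [cite: Zhang2022LandauSiegel, Prop 7.1 p.44, (7.19)–(7.21)] -/
theorem bulkWeight_anchor_eq (a x y : ℝ) {ξ : ℝ} (hξ : ξ ≠ 0) :
    ξ ^ 2 + symE1 ![a, x, y] * ξ + symE2 ![a, x, y] + symE3 ![a, x, y] / ξ
      = (ξ + a) / ξ * ((ξ + x) * (ξ + y)) := by
  simp only [symE1, symE2, symE3, Matrix.cons_val_zero, Matrix.cons_val_one, Matrix.cons_val_two,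
    Matrix.head_cons, Matrix.tail_cons]
  field_simp
  ring

/-- **The anchor law on the lattice:** `(ξ+a)/ξ ≥ 0` for every integer `ξ` iff … — here the direction used:
for `a ∈ [0,1]` and every `ξ : ℤ` (Lean's value `a/0 = 0` at `ξ = 0`).
[cite: Zhang2022LandauSiegel, Prop 7.1 p.44, (7.2)] -/
theorem anchorWeight_nonneg (ha : a ∈ Icc (0:ℝ) 1) (ξ : ℤ) : 0 ≤ ((ξ : ℝ) + a) / ξ := by
  rcases lt_trichotomy ξ 0 with hneg | h0 | hpos
  · have h1 : ξ + 1 ≤ 0 := Int.lt_iff_add_one_le.mp hneg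
    have h1' : (ξ : ℝ) + 1 ≤ 0 := by exact_mod_cast h1
    exact div_nonneg_of_nonpos (by linarith [ha.2]) (by linarith)
  · subst h0; simp
  · have h1 : 0 + 1 ≤ ξ := Int.lt_iff_add_one_le.mp hpos
    have h1' : (1 : ℝ) ≤ ξ := by exact_mod_cast (by simpa using h1)
    exact div_nonneg (by linarith [ha.1]) (by linarith)

/-- **THE GRAM SERIES (LINE B′ §2).** On the apex-and-mean-vanishing sub-class the entangled block form is
`m(a;b;h) = Σ_ξ π·[(ξ+a)/ξ]·Σ_{j,l} Re m₀(a,b_j,b_l)·d_j(ξ)·conj d_l(ξ)`, `d_j(ξ) = (ξ+b_j)·ĥ_j(ξ)` (the `ξ = 0`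
summand is `0`: `ĥ_j(0) = ∫h_j = 0`, and Lean's `a/0 = 0`). Any anchor, any palette (repeats allowed), any `K`.
[cite: Zhang2022LandauSiegel, Prop 7.1 p.44 with (7.2), (7.19)–(7.21), (8.11)–(8.23)] -/
theorem hasSum_entangledMain_clamped_gram (hh : ∀ j, KinkedProfile (h j) (h' j)) (h1 : ∀ j, h j 1 = 0)
    (h0 : ∀ j, h j 0 = 0) (hI : ∀ j, (∫ x in (0:ℝ)..1, h j x) = 0) :
    HasSum (fun ξ : ℤ => (((π * (((ξ : ℝ) + a) / ξ)) : ℝ) : ℂ) *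
        ∑ j, ∑ l, ((ddM0 ![a, b j, b l]).re : ℂ) *
          (((((ξ : ℝ) + b j : ℝ)) : ℂ) * ghat (h j) ξ * conj (((((ξ : ℝ) + b l : ℝ)) : ℂ) * ghat (h l) ξ)))
      (entangledMain a b h h') := by
  have H := hasSum_entangledMain_clamped (a := a) (b := b) hh h1 h0 hI
  have hfun : (fun ξ : ℤ => ∑ j, ∑ l,
        (((π * ((ξ : ℝ) ^ 2 + symE1 ![a, b j, b l] * ξ + symE2 ![a, b j, b l] + symE3 ![a, b j, b l] / ξ)
            * (ddM0 ![a, b j, b l]).re : ℝ)) : ℂ) * (ghat (h j) ξ * conj (ghat (h l) ξ)))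
      = fun ξ : ℤ => (((π * (((ξ : ℝ) + a) / ξ)) : ℝ) : ℂ) *
        ∑ j, ∑ l, ((ddM0 ![a, b j, b l]).re : ℂ) *
          (((((ξ : ℝ) + b j : ℝ)) : ℂ) * ghat (h j) ξ * conj (((((ξ : ℝ) + b l : ℝ)) : ℂ) * ghat (h l) ξ)) := by
    funext ξ
    rw [Finset.mul_sum]
    refine Finset.sum_congr rfl fun j _ => ?_
    rw [Finset.mul_sum]
    refine Finset.sum_congr rfl fun l _ => ?_
    by_cases hξ : ξ = 0
    · subst hξ
      simp [ghat_zero_of_integral_zero (hI j)]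
    · have hξ' : (ξ : ℝ) ≠ 0 := by exact_mod_cast hξ
      rw [bulkWeight_anchor_eq a (b j) (b l) hξ']
      simp only [map_mul, Complex.conj_ofReal]
      push_cast
      ring
  rw [hfun] at H
  exact H

/-- The real part of a complex Hermitian form over a REAL kernel splits into two real quadratic forms:
`Re Σ_{j,l} R_{jl} d_j conj d_l = Σ R_{jl} p_j p_l + Σ R_{jl} q_j q_l` (`d = p + iq`), hence is `≥ 0` when the real
form is. [cite: Zhang2022LandauSiegel, Prop 7.1 p.44, (7.2)] -/
theorem re_gramForm_nonneg (R : Fin K → Fin K → ℝ) (hR : ∀ p : Fin K → ℝ, 0 ≤ ∑ j, ∑ l, p j * p l * R j l)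
    (d : Fin K → ℂ) : 0 ≤ (∑ j, ∑ l, (R j l : ℂ) * (d j * conj (d l))).re := by
  have key : (∑ j, ∑ l, (R j l : ℂ) * (d j * conj (d l))).re
      = (∑ j, ∑ l, (d j).re * (d l).re * R j l) + ∑ j, ∑ l, (d j).im * (d l).im * R j l := by
    rw [Complex.re_sum, ← Finset.sum_add_distrib]
    refine Finset.sum_congr rfl fun j _ => ?_
    rw [Complex.re_sum, ← Finset.sum_add_distrib]
    refine Finset.sum_congr rfl fun l _ => ?_
    simp only [Complex.mul_re, Complex.mul_im, Complex.ofReal_re, Complex.ofReal_im, Complex.conj_re,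
      Complex.conj_im]
    ring
  rw [key]
  exact add_nonneg (hR fun j => (d j).re) (hR fun j => (d j).im)

/-- **T-B′ (LINE B′ rung R2): head 1 on the apex-and-mean-vanishing sub-class, GIVEN the anchor kernel.** For an
anchor `a ∈ [0,1]`, a palette `b : Fin K → ℝ` (any real nodes, repeats allowed) such that the real symmetric
kernel `[Re m₀(a,b_j,b_l)]_{j,l}` is positive-semidefinite (hypothesis `hR` — the cell's L-B′1, NOT proved here),
and every vector of kinked profiles with `h_j(0) = h_j(1) = 0`, `∫₀¹h_j = 0`: `Re m(a;b;h) ≥ 0`. Termwise sign of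
the Gram series: `π ≥ 0`, `(ξ+a)/ξ ≥ 0` (`anchorWeight_nonneg`), `Re Σ R d conj d ≥ 0` (`re_gramForm_nonneg`).
This is `Det.ConePSD a b` RESTRICTED to the sub-class; the full head needs the boundary functionals
(`h_j(0)`, `∫h_j`) — not treated here. [cite: Zhang2022LandauSiegel, Prop 7.1 p.44 with (7.2), (7.19)–(7.21), (8.11)–(8.23)] -/
theorem re_entangledMain_clamped_nonneg (ha : a ∈ Icc (0:ℝ) 1)
    (hR : ∀ p : Fin K → ℝ, 0 ≤ ∑ j, ∑ l, p j * p l * (ddM0 ![a, b j, b l]).re)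
    (hh : ∀ j, KinkedProfile (h j) (h' j)) (h1 : ∀ j, h j 1 = 0) (h0 : ∀ j, h j 0 = 0)
    (hI : ∀ j, (∫ x in (0:ℝ)..1, h j x) = 0) :
    0 ≤ (entangledMain a b h h').re := by
  have hs := Complex.hasSum_re (hasSum_entangledMain_clamped_gram (a := a) (b := b) hh h1 h0 hI)
  refine hs.nonneg fun ξ => ?_
  rw [Complex.re_ofReal_mul]
  refine mul_nonneg (mul_nonneg Real.pi_pos.le (anchorWeight_nonneg ha ξ)) ?_
  have := re_gramForm_nonneg (fun j l => (ddM0 ![a, b j, b l]).re) hR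
    (fun j => ((((ξ : ℝ) + b j : ℝ)) : ℂ) * ghat (h j) ξ)
  simpa only using this

/-- **T-B′ with the anchor-kernel hypothesis in its announced `∀ n x p` shape** (the statement form of the cell's
L-B′1 leaf `Det.re_ddM0_sum_nonneg` (`DetectorAnchorKernel`, ls-Bdet-num-2 g4, p488885)): for `a ∈ [0,1]`, IF `Σ_{j,l} p_j p_l Re m₀(a,x_j,x_l) ≥ 0`
for every finite real node vector `x` and real `p`, THEN for every `K`, every palette `b : Fin K → ℝ` and every
profile vector of the sub-class `Re m(a;b;h) ≥ 0`. One-term composition when that leaf lands; nothing about `a`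
is asserted here. [cite: Zhang2022LandauSiegel, Prop 7.1 p.44 with (7.2), (7.19)–(7.21), (8.11)–(8.23)] -/
theorem re_entangledMain_clamped_nonneg_of_anchorPSD (ha : a ∈ Icc (0:ℝ) 1)
    (hLB : ∀ (n : ℕ) (x p : Fin n → ℝ), 0 ≤ ∑ j, ∑ l, p j * p l * (ddM0 ![a, x j, x l]).re)
    (b : Fin K → ℝ) (hh : ∀ j, KinkedProfile (h j) (h' j)) (h1 : ∀ j, h j 1 = 0) (h0 : ∀ j, h j 0 = 0)
    (hI : ∀ j, (∫ x in (0:ℝ)..1, h j x) = 0) :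
    0 ≤ (entangledMain a b h h').re :=
  re_entangledMain_clamped_nonneg ha (fun p => hLB K b p) hh h1 h0 hI

/-! ### Part 4 (v2) — the sub-class head UNCONDITIONALLY (L-B′1 = `Det.re_ddM0_sum_nonneg`, `DetectorAnchorKernel`) -/

/-- **T-B′ UNCONDITIONAL: head 1 of E-102 holds on the apex-and-mean-vanishing sub-class.** For every anchor
`a ∈ (0,1]`, every palette `b : Fin K → ℝ` (any real nodes, repeats allowed) and every vector of kinked profiles with
`h_j(0) = h_j(1) = 0`, `∫₀¹h_j = 0`: `Re m(a;b;h) ≥ 0`. Composition of `re_entangledMain_clamped_nonneg_of_anchorPSD`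
with the anchor-kernel theorem `Det.re_ddM0_sum_nonneg` (ls-Bdet-num-2 g4, `DetectorAnchorKernel`: the real
symmetric kernel `Re m₀(a,·,·)` is positive-semidefinite on all of `ℝ` for `a ∈ (0,2)`). WHAT IT IS NOT: not
`Det.ConePSD a b` (profiles with `h_j(0) ≠ 0` or `∫h_j ≠ 0` are not covered — the boundary coupling of head 1 is
open), not `Det.EdetCone`. [cite: Zhang2022LandauSiegel, Prop 7.1 p.44 with (7.2), (7.19)–(7.21), (8.11)–(8.23)] -/
theorem re_entangledMain_clamped_nonneg_unconditional (ha : a ∈ Ioc (0:ℝ) 1) (b : Fin K → ℝ)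
    (hh : ∀ j, KinkedProfile (h j) (h' j)) (h1 : ∀ j, h j 1 = 0) (h0 : ∀ j, h j 0 = 0)
    (hI : ∀ j, (∫ x in (0:ℝ)..1, h j x) = 0) :
    0 ≤ (entangledMain a b h h').re :=
  re_entangledMain_clamped_nonneg_of_anchorPSD ⟨ha.1.le, ha.2⟩
    (fun _ x p => re_ddM0_sum_nonneg ⟨ha.1, by linarith [ha.2]⟩ x p) b hh h1 h0 hI

/-- The same for the registry's open anchor range `a ∈ (0,1)` (E-102's `Set.Ioo 0 1`).
[cite: Zhang2022LandauSiegel, Prop 7.1 p.44 with (7.2), (7.19)–(7.21), (8.11)–(8.23)] -/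
theorem re_entangledMain_clamped_nonneg_of_mem_Ioo (ha : a ∈ Ioo (0:ℝ) 1) (b : Fin K → ℝ)
    (hh : ∀ j, KinkedProfile (h j) (h' j)) (h1 : ∀ j, h j 1 = 0) (h0 : ∀ j, h j 0 = 0)
    (hI : ∀ j, (∫ x in (0:ℝ)..1, h j x) = 0) :
    0 ≤ (entangledMain a b h h').re :=
  re_entangledMain_clamped_nonneg_unconditional ⟨ha.1, ha.2.le⟩ b hh h1 h0 hI

end Entangled

end Det

end Literature.NumberTheory.LFunctions.Zhang2022
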